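import Literature.Analysis.FluidPDE.QuasiSelfSimilarGenerators
import Literature.Analysis.FluidPDE.BoxTransportConservation
import Mathlib.MeasureTheory.Integral.Pi
import HarnessLib

/-!
# Generator moves: the bent channel inherits its normalisation from the straight one
(Alberti–Crippa–Mazzucato 2019, §8.3 (c'), Remark 24 (iv); Bruè–De Lellis 2023, §4.1 (ii), (iv))

Topic `Literature/Analysis/FluidPDE`. Continuation of `QuasiSelfSimilarGenerators.lean`, which
reduces the named fact `acm_compatible_blocks` (`QuasiSelfSimilarCompatibleBlocks.lean`) to two
generator blocks `(V_S, Θ_S)` (straight channel) and `(V_B, Θ_B)` (bent channel) with the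
single-block clauses `QuasiSelfSimilar.IsGeneratorBlock`, an equivariant gate field, a snake
table and generator-level self-similarity (`acm_compatible_blocks_of_generators`).

Among the single-block clauses, two are *integrals of the initial datum*: zero average
`∫_{[0,1)²} Θ(0,·) = 0` and unit mass `∫_{[0,1)²} Θ(0,·)² = 1` (BDL §4.1 (ii); ACM §8.3 (c'):
"the two curves have the same length", which is what makes the masses of the two channels
agree). For the straight channel these are one-dimensional integrals of the transversal profile
(Fubini on the square, `setIntegral_unitCube_mul_coord` below). For the bent channel they are
NOT needed as hypotheses: this file shows that they follow from the clauses of the straight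
channel. Indeed, by self-similarity the straight channel at time `1` consists, on the `25`
subsquares, of rescaled symmetric copies of the two initial data, at least one of them bent
(a Hamiltonian arrangement of `25` subsquares joining the midpoints of two opposite sides must
turn); the cube integral of `Φ ∘ Θ_S(1,·)` is therefore `25⁻¹ (n_S I_Φ(S) + n_B I_Φ(B))` with
`I_Φ(g) = ∫_{[0,1)²} Φ(Θ_g(0,·))` and `n_B ≥ 1` (change of variables on each subsquare,
invariance of cube integrals under the symmetries of the square), while by conservation under
the incompressible tangential transport (ACM Remark 24 (iv), `BoxTransportConservation.lean`) it
equals `I_Φ(S)`; hence `I_Φ(B) = I_Φ(S)` for every `C¹` function `Φ`, in particular for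
`Φ = id` and `Φ = (·)²`.

Contents:

* `QuasiSelfSimilar.IsGeneratorMove` — the clauses of `IsGeneratorBlock` except the two
  normalisations at `t = 0` (a smooth incompressible tangential *move* of a channel with the
  boundary structure, whatever its initial mass), with `IsGeneratorBlock.toMove` and
  `IsGeneratorMove.toBlock`;
* `IsGeneratorMove.setIntegral_comp_eq` — conservation of `∫ Φ(Θ(t,·))` on `[0,1]`;
* `setIntegral_comp_one_eq_sum` — the cell decomposition of `∫ Φ(Θ_g(1,·))` under
  generator-level self-similarity; `sum_childGen_eq` — the bookkeeping of the two child types;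
* `setIntegral_comp_bent_eq_straight` — `I_Φ(B) = I_Φ(S)`;
* `acm_compatible_blocks_of_generator_moves` — the main reduction with the weaker hypothesis on
  the bent channel: a straight generator BLOCK, a bent generator MOVE, an equivariant gate field,
  a snake table placing at least one bent child in the straight channel, and generator-level
  self-similarity give `acm_compatible_blocks`; `acm_compatible_blocks_of_generator_moves_peano`
  — the same with the snake table `peanoChildGen/peanoChildSym` of the parent file (which has
  `12` bent children in the straight channel);
* `setIntegral_unitCube_mul_coord`, `setIntegral_unitCube_comp_coord_one`,
  `setIntegral_unitCube_comp_coord_zero` — Fubini on the fundamental square for products of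
  functions of one coordinate (the form in which the two normalisations of a straight channel
  `Θ_S(0, z) = G(z₁ - 1/2)` become `∫ G = 0`, `∫ G² = 1`).

Everything here is proved; the file states no named fact. After it, a discharge of
`acm_compatible_blocks` needs the two integrals only for the straight channel.

## References

* G. Alberti, G. Crippa, A. L. Mazzucato, *Exponential self-similar mixing by incompressible
  flows*, J. Amer. Math. Soc. 32 (2019), 445–490: §8.1 (e), §8.3 (c'), Remark 24 (iv)
  (arXiv:1605.02090).
* E. Bruè, C. De Lellis, *Anomalous dissipation for the forced 3D Navier–Stokes equations*,
  Comm. Math. Phys. 400 (2023), 1507–1533, §4.1 (ii), (iv).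
-/

noncomputable section

open MeasureTheory Set Filter Function

open scoped ContDiff

namespace Literature.Analysis.FluidPDE

namespace QuasiSelfSimilar

open FunctionSpaces FunctionSpaces.Torus

/-! ## Generator moves -/

/-- **Generator move**: the clauses of `IsGeneratorBlock` for a single block `(V, Θ)` with gates
`gate`, relative to the gate fields `(Vg, Θg)` and the margin `δ`, EXCEPT the two normalisations
of the initial datum (zero average, unit mass): smoothness, incompressibility, tangency and
transport on `[0,1] × [0,1]²`, `|Θ| ≤ 10`, vanishing on the boundary strips away from the gate
windows and agreement with the gate field inside them (ACM 2019, §8.4 (a)–(c), §8.5; BDL 2023,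
§4.1 (i), (iii)). [cite: AlbertiCrippaMazzucato2019, §8.4 (a)–(c)] -/
structure IsGeneratorMove (V : ℝ → EuclideanSpace ℝ (Fin 2) → EuclideanSpace ℝ (Fin 2))
    (Θ : ℝ → EuclideanSpace ℝ (Fin 2) → ℝ) (gate : Fin 2 → Bool → Bool)
    (Vg : Fin 2 → ℝ → EuclideanSpace ℝ (Fin 2) → EuclideanSpace ℝ (Fin 2))
    (Θg : Fin 2 → ℝ → EuclideanSpace ℝ (Fin 2) → ℝ) (δ : ℝ) : Prop where
  /-- `V ∈ C^∞(ℝ × ℝ²)`. -/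
  smooth_velocity : ContDiff ℝ ∞ (uncurry V)
  /-- `Θ ∈ C^∞(ℝ × ℝ²)`. -/
  smooth_scalar : ContDiff ℝ ∞ (uncurry Θ)
  /-- `div V(t) = 0` on `[0,1] × [0,1]²`. -/
  divFree : ∀ t ∈ Icc (0 : ℝ) 1, ∀ z ∈ closedSquare,
    ∑ j, fderiv ℝ (V t) z (EuclideanSpace.single j 1) j = 0
  /-- `V(t)` is tangent to `∂[0,1]²`. -/
  tangent : ∀ t ∈ Icc (0 : ℝ) 1, ∀ z ∈ closedSquare, ∀ j, (z j = 0 ∨ z j = 1) → V t z j = 0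
  /-- transport `∂ₜΘ + DΘ[V] = 0` on `[0,1] × [0,1]²`. -/
  transport : ∀ t ∈ Icc (0 : ℝ) 1, ∀ z ∈ closedSquare,
    deriv (fun s => Θ s z) t + fderiv ℝ (Θ t) z (V t z) = 0
  /-- `|Θ| ≤ 10` on `[0,1] × [0,1]²`. -/
  abs_le : ∀ t ∈ Icc (0 : ℝ) 1, ∀ z ∈ closedSquare, |Θ t z| ≤ 10
  /-- vanishing on the boundary strips away from the gate windows. -/
  vanish : ∀ (t : ℝ) (z : EuclideanSpace ℝ (Fin 2)) (k : Fin 2) (s : Bool),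
    |z k - faceValue s| < δ → (¬ gate k s = true ∨ ∃ j, j ≠ k ∧ δ ≤ |z j - 2⁻¹|) →
      V t z = 0 ∧ Θ t z = 0
  /-- agreement with the gate field inside the gate windows. -/
  eq_gate : ∀ (t : ℝ) (z : EuclideanSpace ℝ (Fin 2)) (k : Fin 2) (s : Bool), gate k s = true →
    |z k - faceValue s| < δ → (∀ j, j ≠ k → |z j - 2⁻¹| < 2 * δ) →
      V t z = Vg k t (z - faceMidpoint k s) ∧ Θ t z = Θg k t (z - faceMidpoint k s)

section MoveBlock

variable {V : ℝ → EuclideanSpace ℝ (Fin 2) → EuclideanSpace ℝ (Fin 2)}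
  {Θ : ℝ → EuclideanSpace ℝ (Fin 2) → ℝ} {gate : Fin 2 → Bool → Bool}
  {Vg : Fin 2 → ℝ → EuclideanSpace ℝ (Fin 2) → EuclideanSpace ℝ (Fin 2)}
  {Θg : Fin 2 → ℝ → EuclideanSpace ℝ (Fin 2) → ℝ} {δ : ℝ}

/-- A generator block is in particular a generator move. [folklore] -/
theorem IsGeneratorBlock.toMove (h : IsGeneratorBlock V Θ gate Vg Θg δ) :
    IsGeneratorMove V Θ gate Vg Θg δ where
  smooth_velocity := h.smooth_velocity
  smooth_scalar := h.smooth_scalar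
  divFree := h.divFree
  tangent := h.tangent
  transport := h.transport
  abs_le := h.abs_le
  vanish := h.vanish
  eq_gate := h.eq_gate

/-- A generator move whose initial datum has zero average and unit mass is a generator block.
[folklore] -/
theorem IsGeneratorMove.toBlock (h : IsGeneratorMove V Θ gate Vg Θg δ)
    (h0 : ∫ z in unitCube (Fin 2), Θ 0 z = 0) (h1 : ∫ z in unitCube (Fin 2), Θ 0 z ^ 2 = 1) :
    IsGeneratorBlock V Θ gate Vg Θg δ where
  smooth_velocity := h.smooth_velocity
  smooth_scalar := h.smooth_scalar
  divFree := h.divFree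
  tangent := h.tangent
  transport := h.transport
  zeroMean_zero := h0
  unitL2_zero := h1
  abs_le := h.abs_le
  vanish := h.vanish
  eq_gate := h.eq_gate

/-- The time slices of the scalar of a generator move are continuous. [folklore] -/
theorem IsGeneratorMove.continuous_scalar (h : IsGeneratorMove V Θ gate Vg Θg δ) (t : ℝ) :
    Continuous (Θ t) :=
  h.smooth_scalar.continuous.comp (continuous_const.prodMk continuous_id)

/-- **Conservation along a generator move** (ACM 2019, Remark 24 (iv); BDL 2023, §4.1 (ii)): for
every `C¹` function `Φ`, `∫_{[0,1)²} Φ(Θ(t,·)) = ∫_{[0,1)²} Φ(Θ(0,·))` for `t ∈ [0,1]` — the move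
is an incompressible transport tangent to the boundary of the square.
[cite: AlbertiCrippaMazzucato2019, Remark 24 (iv)] -/
theorem IsGeneratorMove.setIntegral_comp_eq (h : IsGeneratorMove V Θ gate Vg Θg δ) {Φ : ℝ → ℝ}
    (hΦ : ContDiff ℝ 1 Φ) {t : ℝ} (ht : t ∈ Icc (0 : ℝ) 1) :
    ∫ z in unitCube (Fin 2), Φ (Θ t z) = ∫ z in unitCube (Fin 2), Φ (Θ 0 z) :=
  BoxTransport.setIntegral_unitCube_comp_eq_of_transport (n := 1) (V := V) (Θ := Θ) (a := 0)
    (b := 1) hΦ (h.smooth_velocity.of_le ENat.LEInfty.out)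
    (h.smooth_scalar.of_le ENat.LEInfty.out) (fun s hs z hz => h.divFree s hs z hz)
    (fun s hs z hz => h.tangent s hs z hz) (fun s hs z hz => h.transport s hs z hz) ht

end MoveBlock

/-! ## Cell decomposition at time `1` under generator-level self-similarity -/

section Cells

variable {Θ₀ : Gen → ℝ → EuclideanSpace ℝ (Fin 2) → ℝ}
  {childGen : Gen → (Fin 2 → Fin 5) → Gen} {childSym : Gen → (Fin 2 → Fin 5) → SymmCode}

/-- **Cell decomposition of a cube integral at time `1`.** If the generator `g` is self-similar
at `t = 1` with respect to the snake table (`Θ_g(1, z) = (σ • Θ_{g'})(0, 5z - p)` on the open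
subsquare `p`, `(g', σ) = (childGen g p, childSym g p)`), then for every continuous `Φ`
`∫_{[0,1)²} Φ(Θ_g(1,·)) = Σ_p 25⁻¹ ∫_{[0,1)²} Φ(Θ_{childGen g p}(0,·))`: split the square into
its `25` subsquares, extend the cell formula to the half-open subsquare by continuity, change
variables `w = 5z - p` (Jacobian `25`) and use the invariance of cube integrals under the
symmetries of the square (BDL 2023, proof of Thm. 4.1 (b)). [cite: BrueDeLellisCMP2023, Thm. 4.1 (b)] -/
theorem setIntegral_comp_one_eq_sum (g : Gen) {Φ : ℝ → ℝ} (hΦ : Continuous Φ)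
    (hc1 : Continuous (Θ₀ g 1)) (hc0 : ∀ g', Continuous (Θ₀ g' 0))
    (hS : ∀ (p : Fin 2 → Fin 5), ∀ z ∈ latticeCellInterior 5 (fun k => ((p k : ℕ) : ℤ)),
      Θ₀ g 1 z = (childSym g p).toSymm.actScalar (Θ₀ (childGen g p)) 0
        ((5 : ℝ) • z - latticeVec (fun k => ((p k : ℕ) : ℤ)))) :
    ∫ z in unitCube (Fin 2), Φ (Θ₀ g 1 z) =
      ∑ p : Fin 2 → Fin 5, (25 : ℝ)⁻¹ * ∫ z in unitCube (Fin 2), Φ (Θ₀ (childGen g p) 0 z) := by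
  classical
  have h5 : (0 : ℕ) < 5 := by norm_num
  rw [setIntegral_unitCube_eq_sum_latticeCell (m := 5) h5
    (integrableOn_unitCube_of_continuous (g := fun z => Φ (Θ₀ g 1 z)) (hΦ.comp hc1))]
  refine Finset.sum_congr rfl fun p _ => ?_
  set σ : SquareSymm := (childSym g p).toSymm with hσ
  set v : Fin 2 → ℤ := fun k => ((p k : ℕ) : ℤ) with hv
  -- the cell formula, composed with `Φ`, on the half-open subsquare
  have hcont : Continuous fun z : EuclideanSpace ℝ (Fin 2) =>
      Φ (σ.actScalar (Θ₀ (childGen g p)) 0 ((5 : ℝ) • z - latticeVec v)) := by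
    simp only [SquareSymm.actScalar_apply]
    exact hΦ.comp ((hc0 _).comp (σ.inv.continuous_act.comp
      ((continuous_const_smul (5 : ℝ)).sub continuous_const)))
  have hEq : EqOn (fun z => Φ (Θ₀ g 1 z))
      (fun z => Φ (σ.actScalar (Θ₀ (childGen g p)) 0 ((5 : ℝ) • z - latticeVec v)))
      (latticeCell 5 v) := by
    refine eqOn_latticeCell_of_eqOn_interior h5 (hΦ.comp hc1) hcont fun z hz => ?_
    show Φ (Θ₀ g 1 z) = _
    rw [hS p z hz]
  have hres := setIntegral_latticeCell_comp_rescale h5 v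
    (fun w => Φ (σ.actScalar (Θ₀ (childGen g p)) 0 w))
  simp only [Nat.cast_ofNat] at hres
  rw [setIntegral_congr_fun measurableSet_latticeCell hEq, hres]
  simp only [Fintype.card_fin, SquareSymm.actScalar_apply, smul_eq_mul]
  rw [σ.setIntegral_unitCube_comp_inv_act (fun w => Φ (Θ₀ (childGen g p) 0 w))]
  norm_num

/-- **Bookkeeping of the two child types**: a sum over the `25` children of a quantity depending
only on the child's type is `25 I(S) + n_B (I(B) - I(S))`, `n_B` the number of bent children.
[folklore] -/
theorem sum_childGen_eq (I : Gen → ℝ) (g : Gen) :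
    ∑ p : Fin 2 → Fin 5, I (childGen g p) =
      25 * I Gen.S +
        ((Finset.univ.filter fun p : Fin 2 → Fin 5 => childGen g p = Gen.B).card : ℝ) *
          (I Gen.B - I Gen.S) := by
  classical
  have hpt : ∀ p : Fin 2 → Fin 5,
      I (childGen g p) = I Gen.S + (if childGen g p = Gen.B then 1 else 0) * (I Gen.B - I Gen.S) := by
    intro p
    cases h : childGen g p <;> simp
  simp_rw [hpt]
  rw [Finset.sum_add_distrib, Finset.sum_const, Finset.card_univ, ← Finset.sum_mul, Finset.sum_boole]
  simp only [Fintype.card_pi, Fintype.card_fin, Finset.prod_const, Finset.card_univ, nsmul_eq_mul]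
  norm_num

end Cells

/-! ## The bent channel inherits the normalisation of the straight one -/

section Inherit

variable {V₀ : Gen → ℝ → EuclideanSpace ℝ (Fin 2) → EuclideanSpace ℝ (Fin 2)}
  {Θ₀ : Gen → ℝ → EuclideanSpace ℝ (Fin 2) → ℝ}
  {Vg : Fin 2 → ℝ → EuclideanSpace ℝ (Fin 2) → EuclideanSpace ℝ (Fin 2)}
  {Θg : Fin 2 → ℝ → EuclideanSpace ℝ (Fin 2) → ℝ} {δ : ℝ}
  {childGen : Gen → (Fin 2 → Fin 5) → Gen} {childSym : Gen → (Fin 2 → Fin 5) → SymmCode}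

/-- **The bent channel inherits every conserved integral from the straight one** (ACM 2019,
§8.3 (c') with Remark 24 (iv); BDL 2023, §4.1 (ii), (iv)). Let the straight generator be a
generator move, self-similar at `t = 1` with respect to a snake table that places at least one
bent child in it, and let `Θ_B(0,·)` be continuous. Then for every `C¹` function `Φ`,
`∫_{[0,1)²} Φ(Θ_B(0,·)) = ∫_{[0,1)²} Φ(Θ_S(0,·))`: by conservation and the cell decomposition,
`I_Φ(S) = 25⁻¹ (25 I_Φ(S) + n_B (I_Φ(B) - I_Φ(S)))` with `n_B ≥ 1`.
[cite: AlbertiCrippaMazzucato2019, §8.3 (c') and Remark 24 (iv)] -/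
theorem setIntegral_comp_bent_eq_straight
    (hSm : IsGeneratorMove (V₀ Gen.S) (Θ₀ Gen.S) (genGate Gen.S) Vg Θg δ)
    (hBc : Continuous (Θ₀ Gen.B 0))
    (hS : ∀ (p : Fin 2 → Fin 5), ∀ z ∈ latticeCellInterior 5 (fun k => ((p k : ℕ) : ℤ)),
      Θ₀ Gen.S 1 z = (childSym Gen.S p).toSymm.actScalar (Θ₀ (childGen Gen.S p)) 0
        ((5 : ℝ) • z - latticeVec (fun k => ((p k : ℕ) : ℤ))))
    (hbent : ∃ p, childGen Gen.S p = Gen.B) {Φ : ℝ → ℝ} (hΦ : ContDiff ℝ 1 Φ) :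
    ∫ z in unitCube (Fin 2), Φ (Θ₀ Gen.B 0 z) = ∫ z in unitCube (Fin 2), Φ (Θ₀ Gen.S 0 z) := by
  classical
  set I : Gen → ℝ := fun g => ∫ z in unitCube (Fin 2), Φ (Θ₀ g 0 z) with hI
  have hc0 : ∀ g', Continuous (Θ₀ g' 0) := by
    intro g'
    cases g'
    · exact hSm.continuous_scalar 0
    · exact hBc
  -- conservation on `[0,1]` and cell decomposition at `t = 1`
  have hcons : ∫ z in unitCube (Fin 2), Φ (Θ₀ Gen.S 1 z) = I Gen.S :=
    hSm.setIntegral_comp_eq hΦ ⟨zero_le_one, le_rfl⟩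
  have hsplit := setIntegral_comp_one_eq_sum (Θ₀ := Θ₀) Gen.S hΦ.continuous
    (hSm.continuous_scalar 1) hc0 hS
  rw [hcons, ← Finset.mul_sum, sum_childGen_eq I Gen.S] at hsplit
  -- `n_B ≥ 1`
  set nB : ℕ := (Finset.univ.filter fun p : Fin 2 → Fin 5 => childGen Gen.S p = Gen.B).card with hnB
  have hnB1 : (1 : ℝ) ≤ nB := by
    obtain ⟨p, hp⟩ := hbent
    have : 0 < nB := Finset.card_pos.2 ⟨p, by simp [hp]⟩
    exact_mod_cast this
  -- `I S = 25⁻¹ (25 I S + nB (I B - I S))` forces `I B = I S`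
  have hkey : (nB : ℝ) * (I Gen.B - I Gen.S) = 0 := by linarith
  rcases mul_eq_zero.1 hkey with h | h
  · exfalso; linarith
  · exact sub_eq_zero.1 h

/-- Zero average of the bent channel from the clauses of the straight one. [cite: BrueDeLellisCMP2023, §4.1 (ii)] -/
theorem zeroMean_bent_of_straight
    (hSb : IsGeneratorBlock (V₀ Gen.S) (Θ₀ Gen.S) (genGate Gen.S) Vg Θg δ)
    (hBc : Continuous (Θ₀ Gen.B 0))
    (hS : ∀ (p : Fin 2 → Fin 5), ∀ z ∈ latticeCellInterior 5 (fun k => ((p k : ℕ) : ℤ)),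
      Θ₀ Gen.S 1 z = (childSym Gen.S p).toSymm.actScalar (Θ₀ (childGen Gen.S p)) 0
        ((5 : ℝ) • z - latticeVec (fun k => ((p k : ℕ) : ℤ))))
    (hbent : ∃ p, childGen Gen.S p = Gen.B) :
    ∫ z in unitCube (Fin 2), Θ₀ Gen.B 0 z = 0 := by
  have h := setIntegral_comp_bent_eq_straight hSb.toMove hBc hS hbent (Φ := fun r => r) contDiff_id
  rw [h]
  exact hSb.zeroMean_zero

/-- Unit mass of the bent channel from the clauses of the straight one (ACM 2019, §8.3 (c'): the
lengths, i.e. the masses, of the two channels agree). [cite: AlbertiCrippaMazzucato2019, §8.3 (c')] -/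
theorem unitL2_bent_of_straight
    (hSb : IsGeneratorBlock (V₀ Gen.S) (Θ₀ Gen.S) (genGate Gen.S) Vg Θg δ)
    (hBc : Continuous (Θ₀ Gen.B 0))
    (hS : ∀ (p : Fin 2 → Fin 5), ∀ z ∈ latticeCellInterior 5 (fun k => ((p k : ℕ) : ℤ)),
      Θ₀ Gen.S 1 z = (childSym Gen.S p).toSymm.actScalar (Θ₀ (childGen Gen.S p)) 0
        ((5 : ℝ) • z - latticeVec (fun k => ((p k : ℕ) : ℤ))))
    (hbent : ∃ p, childGen Gen.S p = Gen.B) :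
    ∫ z in unitCube (Fin 2), Θ₀ Gen.B 0 z ^ 2 = 1 := by
  have h := setIntegral_comp_bent_eq_straight hSb.toMove hBc hS hbent (Φ := fun r => r ^ 2)
    (contDiff_id.pow 2)
  rw [h]
  exact hSb.unitL2_zero

end Inherit

end QuasiSelfSimilar

/-! ## The main reduction with the weaker hypothesis on the bent channel -/

open QuasiSelfSimilar FunctionSpaces FunctionSpaces.Torus

/-- **`acm_compatible_blocks` from a straight generator block and a bent generator move**
(Alberti–Crippa–Mazzucato 2019, §6.5, §8.1 (e), §8.3 (c'), §8.6, Remark 24 (iv); Bruè–De Lellis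
2023, §4.1). As `acm_compatible_blocks_of_generators`, but the bent channel is only required to
be a generator MOVE (`IsGeneratorMove`: no hypothesis on the average and the mass of its initial
datum), provided the snake table places at least one bent child in the straight channel: the
two missing clauses are inherited from the straight channel (`zeroMean_bent_of_straight`,
`unitL2_bent_of_straight`). [cite: AlbertiCrippaMazzucato2019, §8.1 (e), §8.3 (c'), §8.6] [cite: BrueDeLellisCMP2023, §4.1] -/
theorem acm_compatible_blocks_of_generator_moves
    {V₀ : Gen → ℝ → EuclideanSpace ℝ (Fin 2) → EuclideanSpace ℝ (Fin 2)}
    {Θ₀ : Gen → ℝ → EuclideanSpace ℝ (Fin 2) → ℝ}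
    {Vg : Fin 2 → ℝ → EuclideanSpace ℝ (Fin 2) → EuclideanSpace ℝ (Fin 2)}
    {Θg : Fin 2 → ℝ → EuclideanSpace ℝ (Fin 2) → ℝ} {δ : ℝ}
    {childGen : Gen → (Fin 2 → Fin 5) → Gen} {childSym : Gen → (Fin 2 → Fin 5) → SymmCode}
    (hδ : 0 < δ) (hδ' : δ ≤ 8⁻¹)
    (hSb : IsGeneratorBlock (V₀ Gen.S) (Θ₀ Gen.S) (genGate Gen.S) Vg Θg δ)
    (hBm : IsGeneratorMove (V₀ Gen.B) (Θ₀ Gen.B) (genGate Gen.B) Vg Θg δ)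
    (hG : IsEquivariantGateField Vg Θg)
    (hT : IsSnakeTable childGen childSym)
    (hbent : ∃ p, childGen Gen.S p = Gen.B)
    (hS : ∀ (g : Gen) (p : Fin 2 → Fin 5), ∀ z ∈ latticeCellInterior 5 (fun k => ((p k : ℕ) : ℤ)),
      Θ₀ g 1 z = (childSym g p).toSymm.actScalar (Θ₀ (childGen g p)) 0
        ((5 : ℝ) • z - latticeVec (fun k => ((p k : ℕ) : ℤ)))) :
    acm_compatible_blocks := by
  have hBb : IsGeneratorBlock (V₀ Gen.B) (Θ₀ Gen.B) (genGate Gen.B) Vg Θg δ :=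
    hBm.toBlock (zeroMean_bent_of_straight hSb (hBm.continuous_scalar 0) (hS Gen.S) hbent)
      (unitL2_bent_of_straight hSb (hBm.continuous_scalar 0) (hS Gen.S) hbent)
  refine acm_compatible_blocks_of_generators (V₀ := V₀) hδ hδ' (fun g => ?_) hG hT hS
  cases g
  · exact hSb
  · exact hBb

/-- The snake table of `QuasiSelfSimilarGenerators.lean` places a bent child in the straight
channel (in fact `12` of its `25` children are bent; the subsquare `(0, 2)` at the left gate is
one). [folklore] -/
theorem exists_peanoChildGen_straight_eq_bent : ∃ p : Fin 2 → Fin 5, peanoChildGen Gen.S p = Gen.B := by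
  decide

/-- **`acm_compatible_blocks` from a straight block and a bent move, with the shipped snake
table** `peanoChildGen/peanoChildSym` (checked by `decide` in the parent file). What remains for
`acm_compatible_blocks_holds` after this theorem: the two smooth incompressible moves with the
boundary structure and `|Θ| ≤ 10`, the two normalisations of the STRAIGHT channel only, one
equivariant gate field, and the `2 × 25` cell identities at `t = 1`.
[cite: AlbertiCrippaMazzucato2019, §8.1 (e), §8.3 (c'), §8.6] -/
theorem acm_compatible_blocks_of_generator_moves_peano
    {V₀ : Gen → ℝ → EuclideanSpace ℝ (Fin 2) → EuclideanSpace ℝ (Fin 2)}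
    {Θ₀ : Gen → ℝ → EuclideanSpace ℝ (Fin 2) → ℝ}
    {Vg : Fin 2 → ℝ → EuclideanSpace ℝ (Fin 2) → EuclideanSpace ℝ (Fin 2)}
    {Θg : Fin 2 → ℝ → EuclideanSpace ℝ (Fin 2) → ℝ} {δ : ℝ}
    (hδ : 0 < δ) (hδ' : δ ≤ 8⁻¹)
    (hSb : IsGeneratorBlock (V₀ Gen.S) (Θ₀ Gen.S) (genGate Gen.S) Vg Θg δ)
    (hBm : IsGeneratorMove (V₀ Gen.B) (Θ₀ Gen.B) (genGate Gen.B) Vg Θg δ)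
    (hG : IsEquivariantGateField Vg Θg)
    (hS : ∀ (g : Gen) (p : Fin 2 → Fin 5), ∀ z ∈ latticeCellInterior 5 (fun k => ((p k : ℕ) : ℤ)),
      Θ₀ g 1 z = (peanoChildSym g p).toSymm.actScalar (Θ₀ (peanoChildGen g p)) 0
        ((5 : ℝ) • z - latticeVec (fun k => ((p k : ℕ) : ℤ)))) :
    acm_compatible_blocks :=
  acm_compatible_blocks_of_generator_moves hδ hδ' hSb hBm hG isSnakeTable_peano
    exists_peanoChildGen_straight_eq_bent hS

/-! ## Fubini on the fundamental square for functions of one coordinate -/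

namespace QuasiSelfSimilar

/-- **Fubini on the fundamental square**: `∫_{[0,1)²} F(z₀) G(z₁) dz = (∫_{[0,1)} F)(∫_{[0,1)} G)`
(transfer to `Fin 2 → ℝ` by the volume-preserving `WithLp.ofLp`, then the product formula for
`Measure.pi`). [folklore] -/
theorem setIntegral_unitCube_mul_coord (F G : ℝ → ℝ) :
    ∫ z in unitCube (Fin 2), F (z 0) * G (z 1) =
      (∫ x in Ico (0 : ℝ) 1, F x) * ∫ y in Ico (0 : ℝ) 1, G y := by
  have hmp := PiLp.volume_preserving_ofLp (Fin 2)
  have hemb : MeasurableEmbedding (@WithLp.ofLp 2 (Fin 2 → ℝ)) :=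
    (MeasurableEquiv.toLp 2 (Fin 2 → ℝ)).symm.measurableEmbedding
  have hpre : unitCube (Fin 2) =
      WithLp.ofLp ⁻¹' Set.pi univ fun _ : Fin 2 => Ico (0 : ℝ) 1 := by
    ext z; simp [unitCube]
  have key := hmp.setIntegral_preimage_emb hemb (fun x : Fin 2 → ℝ => F (x 0) * G (x 1))
    (Set.pi univ fun _ : Fin 2 => Ico (0 : ℝ) 1)
  rw [hpre]
  refine key.trans ?_
  rw [volume_pi, Measure.restrict_pi_pi]
  have h := integral_fintype_prod_eq_prod (ι := Fin 2) (𝕜 := ℝ)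
    (fun i : Fin 2 => if i = 0 then F else G) (μ := fun _ : Fin 2 => volume.restrict (Ico (0 : ℝ) 1))
  simpa [Fin.prod_univ_two] using h

/-- The cube integral of a function of the second coordinate: `∫_{[0,1)²} G(z₁) dz = ∫_{[0,1)} G`
(the normalisations of a straight channel `Θ_S(0, z) = G(z₁ - 1/2)` along the axis `0`).
[folklore] -/
theorem setIntegral_unitCube_comp_coord_one (G : ℝ → ℝ) :
    ∫ z in unitCube (Fin 2), G (z 1) = ∫ y in Ico (0 : ℝ) 1, G y := by
  have h := setIntegral_unitCube_mul_coord (fun _ => 1) G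
  simp only [one_mul] at h
  rw [h]
  simp

/-- The cube integral of a function of the first coordinate: `∫_{[0,1)²} F(z₀) dz = ∫_{[0,1)} F`.
[folklore] -/
theorem setIntegral_unitCube_comp_coord_zero (F : ℝ → ℝ) :
    ∫ z in unitCube (Fin 2), F (z 0) = ∫ x in Ico (0 : ℝ) 1, F x := by
  have h := setIntegral_unitCube_mul_coord F (fun _ => 1)
  simp only [mul_one] at h
  rw [h]
  simp

/-- **Normalisations of a straight channel from its profile**: if on the fundamental square the
initial datum is `Θ(0, z) = G(z₁ - 1/2)` with `∫_{[0,1)} G(y - 1/2) dy = 0` and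
`∫_{[0,1)} G(y - 1/2)² dy = 1`, then `Θ(0,·)` has zero average and unit mass on the square.
[folklore] -/
theorem moments_of_transversal_profile {Θ : ℝ → EuclideanSpace ℝ (Fin 2) → ℝ} {G : ℝ → ℝ}
    (hΘ : ∀ z ∈ unitCube (Fin 2), Θ 0 z = G (z 1 - 2⁻¹))
    (h0 : ∫ y in Ico (0 : ℝ) 1, G (y - 2⁻¹) = 0) (h1 : ∫ y in Ico (0 : ℝ) 1, G (y - 2⁻¹) ^ 2 = 1) :
    (∫ z in unitCube (Fin 2), Θ 0 z = 0) ∧ ∫ z in unitCube (Fin 2), Θ 0 z ^ 2 = 1 := by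
  constructor
  · rw [setIntegral_congr_fun measurableSet_unitCube hΘ,
      setIntegral_unitCube_comp_coord_one (fun y => G (y - 2⁻¹))]
    exact h0
  · rw [setIntegral_congr_fun measurableSet_unitCube (fun z hz => by rw [hΘ z hz]),
      setIntegral_unitCube_comp_coord_one (fun y => G (y - 2⁻¹) ^ 2)]
    exact h1

end QuasiSelfSimilar

end Literature.Analysis.FluidPDE

end
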